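import Summits.CriticalPhenomena.PercolationContinuityZ3.Theorems.PercNearOneGluingNoHeavyLowerTailJBernFibreMatching
import HarnessLib

/-!
# `NoHeavyLowerTail` (crux stmt-CriticalPhenomena-4575), hull-port line hp-7: in-fibre SATURATION OF THE `b`-SOURCES and the
# unframed `DOM0` inequality for the coefficientwise (T*) statement J-BERN⁺

Support file (prover `prim-hp-7`, generation 46; `--supports stmt-CriticalPhenomena-4575`).  Pure finite combinatorics, no
definitions, no `sorry`, standard axioms.

THE MATHEMATICS (memo `prim-hp-7/FROM-prim-hp-7-g46-EXPORTS-FREE.md` §1).  On a Reimer fibre of the J-BERN⁺ matching problem the two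
copies `1, 3` of a 3-colouring are complementary subsets `sᶜ, s` of the finite set of free edges.  Write `𝒳` for the upper family
"`x` is joined to `v`" and `𝒴` for the upper family `O2` = "`o` is joined to `x` or to `v`", so that `𝒳 \ 𝒴 = PV`, `𝒳 ∩ 𝒴 = T`
(all three terminals joined) and `𝒴ᶜ = P`.  The `b`-sources of the fibre are `{s ∈ PV, sᶜ ∈ O2} = 𝒳 ∩ (𝒴ᶜˢ \ 𝒴)` and the
`T`-targets are `{s ∈ T, sᶜ ∈ P} = 𝒳 ∩ (𝒴 \ 𝒴ᶜˢ)`.  Generation 45 left the upward saturation of the `b`-sources as a census-clean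
open step ("= DOM0").  It is in fact the weighted fibre inequality of generation 45 applied to the upper family `𝒰 ∩ 𝒳`:
* `card_inter_inter_compls_sdiff_le` : `#(𝒰 ∩ 𝒳 ∩ (𝒴ᶜˢ \ 𝒴)) ≤ #(𝒰 ∩ 𝒳 ∩ (𝒴 \ 𝒴ᶜˢ))` for upper `𝒰, 𝒳, 𝒴` (Hall's condition), [this work]
* `exists_code_monotone_injection` : hence a code-monotone INJECTION of the `b`-sources into the `T`-targets, [this work]
* `card_sdiff_inter_compls_sdiff_le` : the unframed `DOM0` count `#{s ∈ 𝒳 \ 𝒴, sᶜ ∈ 𝒴 \ 𝒳} ≤ #{s ∈ 𝒳 ∩ 𝒴, sᶜ ∉ 𝒳 ∪ 𝒴}`, i.e.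
  `#{U ∈ PV, Ū ∈ E ⊔ O'} ≤ #{U ∈ T, Ū ∈ PM}` for uniform two-colourings (the frame-free case of `prim-ineq-gen-7`'s DOM0). [this work]
-/

namespace Summit.CriticalPhenomena.PercolationContinuityZ3.Theorems.JBern

open Finset Function
open scoped FinsetFamily

variable {α : Type*} [DecidableEq α] [Fintype α]

/-- **Hall's condition for the `b`-sources.**  For upper families `𝒰, 𝒳, 𝒴` of subsets of a finite set:
`#(𝒰 ∩ 𝒳 ∩ (𝒴ᶜˢ \ 𝒴)) ≤ #(𝒰 ∩ 𝒳 ∩ (𝒴 \ 𝒴ᶜˢ))`, i.e. the sources `{s ∈ 𝒳 \ 𝒴, sᶜ ∈ 𝒴}` lying in the upper family `𝒰` are at most as many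
as the targets `{s ∈ 𝒳 ∩ 𝒴, sᶜ ∉ 𝒴}` lying in `𝒰` (the weighted fibre inequality for the upper family `𝒰 ∩ 𝒳`). [this work] -/
theorem card_inter_inter_compls_sdiff_le (𝒰 𝒳 𝒴 : Finset (Finset α)) (h𝒰 : IsUpperSet (𝒰 : Set (Finset α)))
    (h𝒳 : IsUpperSet (𝒳 : Set (Finset α))) (h𝒴 : IsUpperSet (𝒴 : Set (Finset α))) :
    #(𝒰 ∩ 𝒳 ∩ (𝒴ᶜˢ \ 𝒴)) ≤ #(𝒰 ∩ 𝒳 ∩ (𝒴 \ 𝒴ᶜˢ)) := by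
  have h : IsUpperSet ((𝒰 ∩ 𝒳 : Finset (Finset α)) : Set (Finset α)) := by
    rw [coe_inter]; exact h𝒰.inter h𝒳
  exact card_inter_compls_sdiff_le (𝒰 ∩ 𝒳) 𝒴 h h𝒴

/-- **In-fibre saturation of the `b`-sources** (J-BERN⁺, memo §1): for upper families `𝒳, 𝒴` and a monotone code `f` into any preorder
there is an INJECTION from the sources `𝒳 ∩ (𝒴ᶜˢ \ 𝒴) = {s ∈ 𝒳 \ 𝒴 : sᶜ ∈ 𝒴}` into the targets `𝒳 ∩ (𝒴 \ 𝒴ᶜˢ) = {s ∈ 𝒳 ∩ 𝒴 : sᶜ ∉ 𝒴}`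
that never decreases the code (Hall's theorem + `card_inter_inter_compls_sdiff_le`).  With `𝒳 = {x ~ v}`, `𝒴 = {o ~ x or o ~ v}` this
matches every `(O2,PM,PV)`-source of a `PM`-fibre to a `(P,PM,T)`-target of the same fibre. [this work] -/
theorem exists_code_monotone_injection {β : Type*} [Preorder β] (𝒳 𝒴 : Finset (Finset α))
    (h𝒳 : IsUpperSet (𝒳 : Set (Finset α))) (h𝒴 : IsUpperSet (𝒴 : Set (Finset α))) (f : Finset α → β) (hf : Monotone f) :
    ∃ ψ : (𝒳 ∩ (𝒴ᶜˢ \ 𝒴) : Finset (Finset α)) → (𝒳 ∩ (𝒴 \ 𝒴ᶜˢ) : Finset (Finset α)),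
      Injective ψ ∧ ∀ s, f s.1 ≤ f (ψ s).1 := by
  classical
  have hall : ∀ A : Finset (𝒳 ∩ (𝒴ᶜˢ \ 𝒴) : Finset (Finset α)),
      #A ≤ #({b : (𝒳 ∩ (𝒴 \ 𝒴ᶜˢ) : Finset (Finset α)) | ∃ a ∈ A, f a.1 ≤ f b.1} : Finset _) := by
    intro A
    set 𝒰 : Finset (Finset α) := Finset.univ.filter (fun s => ∃ a ∈ A, f a.1 ≤ f s) with h𝒰def
    have h𝒰 : IsUpperSet (𝒰 : Set (Finset α)) := by
      intro s t hst hs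
      rw [Finset.mem_coe, h𝒰def, mem_filter] at hs ⊢
      obtain ⟨a, ha, hle⟩ := hs.2
      exact ⟨mem_univ _, a, ha, hle.trans (hf hst)⟩
    have hA : #A ≤ #(𝒰 ∩ 𝒳 ∩ (𝒴ᶜˢ \ 𝒴)) := by
      have : A.map (Embedding.subtype _) ⊆ 𝒰 ∩ 𝒳 ∩ (𝒴ᶜˢ \ 𝒴) := by
        intro s hs
        rw [mem_map] at hs
        obtain ⟨a, ha, rfl⟩ := hs
        have ha2 := a.2
        rw [mem_inter] at ha2
        refine mem_inter.2 ⟨mem_inter.2 ⟨?_, ha2.1⟩, ha2.2⟩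
        rw [h𝒰def, mem_filter]; exact ⟨mem_univ _, a, ha, le_rfl⟩
      simpa using card_le_card this
    have hB : #(𝒰 ∩ 𝒳 ∩ (𝒴 \ 𝒴ᶜˢ)) ≤ #({b : (𝒳 ∩ (𝒴 \ 𝒴ᶜˢ) : Finset (Finset α)) | ∃ a ∈ A, f a.1 ≤ f b.1} : Finset _) := by
      have himg : 𝒰 ∩ 𝒳 ∩ (𝒴 \ 𝒴ᶜˢ) ⊆
          ({b : (𝒳 ∩ (𝒴 \ 𝒴ᶜˢ) : Finset (Finset α)) | ∃ a ∈ A, f a.1 ≤ f b.1} : Finset _).map (Embedding.subtype _) := by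
        intro s hs
        rw [mem_inter, mem_inter, h𝒰def, mem_filter] at hs
        rw [mem_map]
        refine ⟨⟨s, mem_inter.2 ⟨hs.1.2, hs.2⟩⟩, ?_, rfl⟩
        rw [mem_filter]; exact ⟨mem_univ _, hs.1.1.2⟩
      simpa using card_le_card himg
    exact hA.trans ((card_inter_inter_compls_sdiff_le 𝒰 𝒳 𝒴 h𝒰 h𝒳 h𝒴).trans hB)
  exact (Fintype.all_card_le_filter_rel_iff_exists_injective
    (fun (a : (𝒳 ∩ (𝒴ᶜˢ \ 𝒴) : Finset (Finset α))) (b : (𝒳 ∩ (𝒴 \ 𝒴ᶜˢ) : Finset (Finset α))) => f a.1 ≤ f b.1)).1 hall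

/-- **Unframed `DOM0`.**  For upper families `𝒳, 𝒴` of subsets of a finite set:
`#((𝒳 \ 𝒴) ∩ (𝒴 \ 𝒳)ᶜˢ) ≤ #((𝒳 ∩ 𝒴) \ (𝒳 ∪ 𝒴)ᶜˢ)`, i.e. `#{s ∈ 𝒳 \ 𝒴 : sᶜ ∈ 𝒴 \ 𝒳} ≤ #{s ∈ 𝒳 ∩ 𝒴 : sᶜ ∉ 𝒳 ∪ 𝒴}`.  With `𝒳 = {x ~ v}` and
`𝒴 = {o ~ x or o ~ v}` on the edges of a graph: among uniform two-colourings, `#{U ∈ PV, Ū ∈ E ⊔ O'} ≤ #{U ∈ T, Ū ∈ PM}`, which contains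
the frame-free case `#{U ∈ E, Ū ∈ PV} ≤ #{U ∈ PM, Ū ∈ O}` of DOM0.  Proof: the weighted fibre inequality for `𝒰 = 𝒳`, `𝒞 = 𝒴`, after removing
from both sides the parts `{s ∈ 𝒳 \ 𝒴, sᶜ ∈ 𝒳 ∩ 𝒴}` and `{s ∈ 𝒳 ∩ 𝒴, sᶜ ∈ 𝒳 \ 𝒴}`, which complementation puts in bijection. [this work] -/
theorem card_sdiff_inter_compls_sdiff_le (𝒳 𝒴 : Finset (Finset α)) (h𝒳 : IsUpperSet (𝒳 : Set (Finset α)))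
    (h𝒴 : IsUpperSet (𝒴 : Set (Finset α))) :
    #((𝒳 \ 𝒴) ∩ (𝒴 \ 𝒳)ᶜˢ) ≤ #((𝒳 ∩ 𝒴) \ (𝒳 ∪ 𝒴)ᶜˢ) := by
  have hk : #(𝒳 ∩ (𝒴ᶜˢ \ 𝒴)) ≤ #(𝒳 ∩ (𝒴 \ 𝒴ᶜˢ)) := card_inter_compls_sdiff_le 𝒳 𝒴 h𝒳 h𝒴
  -- split the left side of `hk` according to `sᶜ ∈ 𝒳` or not
  have hL : 𝒳 ∩ (𝒴ᶜˢ \ 𝒴) = (𝒳 \ 𝒴) ∩ (𝒴 \ 𝒳)ᶜˢ ∪ (𝒳 \ 𝒴) ∩ (𝒳 ∩ 𝒴)ᶜˢ := by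
    ext s
    simp only [mem_inter, mem_sdiff, mem_union, mem_compls]
    constructor
    · rintro ⟨hx, hyc, hy⟩
      by_cases hxc : sᶜ ∈ 𝒳
      · exact Or.inr ⟨⟨hx, hy⟩, hxc, hyc⟩
      · exact Or.inl ⟨⟨hx, hy⟩, hyc, hxc⟩
    · rintro (⟨⟨hx, hy⟩, hyc, -⟩ | ⟨⟨hx, hy⟩, -, hyc⟩) <;> exact ⟨hx, hyc, hy⟩
  have hLd : Disjoint ((𝒳 \ 𝒴) ∩ (𝒴 \ 𝒳)ᶜˢ) ((𝒳 \ 𝒴) ∩ (𝒳 ∩ 𝒴)ᶜˢ) := by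
    rw [disjoint_left]
    intro s h1 h2
    simp only [mem_inter, mem_sdiff, mem_compls] at h1 h2
    exact h1.2.2 h2.2.1
  -- split the right side of `hk` according to `sᶜ ∈ 𝒳` or not
  have hR : 𝒳 ∩ (𝒴 \ 𝒴ᶜˢ) = (𝒳 ∩ 𝒴) \ (𝒳 ∪ 𝒴)ᶜˢ ∪ (𝒳 ∩ 𝒴) ∩ (𝒳 \ 𝒴)ᶜˢ := by
    ext s
    simp only [mem_inter, mem_sdiff, mem_union, mem_compls]
    constructor
    · rintro ⟨hx, hy, hyc⟩
      by_cases hxc : sᶜ ∈ 𝒳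
      · exact Or.inr ⟨⟨hx, hy⟩, hxc, hyc⟩
      · exact Or.inl ⟨⟨hx, hy⟩, fun h => h.elim hxc hyc⟩
    · rintro (⟨⟨hx, hy⟩, h⟩ | ⟨⟨hx, hy⟩, -, hyc⟩)
      · exact ⟨hx, hy, fun hyc => h (Or.inr hyc)⟩
      · exact ⟨hx, hy, hyc⟩
  have hRd : Disjoint ((𝒳 ∩ 𝒴) \ (𝒳 ∪ 𝒴)ᶜˢ) ((𝒳 ∩ 𝒴) ∩ (𝒳 \ 𝒴)ᶜˢ) := by
    rw [disjoint_left]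
    intro s h1 h2
    simp only [mem_inter, mem_sdiff, mem_union, mem_compls] at h1 h2
    exact h1.2 (Or.inl h2.2.1)
  -- the two removed parts are in bijection by complementation
  have hbij : #((𝒳 \ 𝒴) ∩ (𝒳 ∩ 𝒴)ᶜˢ) = #((𝒳 ∩ 𝒴) ∩ (𝒳 \ 𝒴)ᶜˢ) := by
    refine card_bij (fun s _ => sᶜ) (fun s hs => ?_) (fun s _ t _ h => compl_injective h) (fun t ht => ?_)
    · simp only [mem_inter, mem_sdiff, mem_compls] at hs
      simp only [mem_inter, mem_sdiff, mem_compls, compl_compl]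
      exact ⟨hs.2, hs.1⟩
    · simp only [mem_inter, mem_sdiff, mem_compls] at ht
      exact ⟨tᶜ, by simp only [mem_inter, mem_sdiff, mem_compls, compl_compl]; exact ⟨ht.2, ht.1⟩, compl_compl t⟩
  rw [hL, hR, card_union_of_disjoint hLd, card_union_of_disjoint hRd, hbij] at hk
  omega

end Summit.CriticalPhenomena.PercolationContinuityZ3.Theorems.JBern
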